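import Mathlib
import HarnessLib
import Summits.Ventures.LatticeQCDFlow.Exactness.SubgroupProductHaar
import Summits.Ventures.LatticeQCDFlow.Exactness.CabibboMarinariSweep
import Summits.Ventures.LatticeQCDFlow.Exactness.RefreshScan

/-!
# One Cabibbo–Marinari hit dominates a Haar kick in its subgroup; a cycle of kicks is a convolution

HONEST FRAMING: exact (Metropolis-corrected) sampling algorithms for lattice gauge theory;
figures of merit are autocorrelation/cost numbers at stated couplings and volumes; no
continuum-physics claim.

Venture `LatticeQCDFlow` (cell pub-lqcd), topic `Exactness`, FANOUT row 9 (eng-latcore, the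
engine `latflow.core`; `update_link` in `csrc/latcore_template.c` runs one Cabibbo–Marinari
heat-bath hit per coordinate pair `(i, j)`, `i < j`, lexicographically).  NEW WORK of the cell
over Mathlib and row 9's earlier files; nothing is cited as a fact.  Printed counterparts, NAMED
ONLY: Diaconis–Shahshahani 1987 (subgroup algorithm); Meyn–Tweedie 1993 Thm 16.0.2 (Doeblin ⇒
uniform ergodicity); Cabibbo–Marinari 1982 (the update).  Part of the proof that the SU(N ≥ 3)
Cabibbo–Marinari heat bath is uniformly ergodic.

## What is proved (`n` a finite nonempty index type; `SU(N) = Matrix.specialUnitaryGroup n ℂ`)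

* §1 `hitConst c R = e^{−2|c| Σ‖R‖} ∈ (0, ∞)`; **`hitConst_smul_kick_le_cmHit`** — one hit
  (`CabibboMarinariKernel.cmHit e c R`) dominates `ε ×` the Haar kick `g ↦ φ_e(h) g`, `h ∼ Haar(SU(2))`
  (the weight is pinched between `e^{±|c| Σ‖R‖}`).
* §2 (any measurable group `G`, kicks by measurable homomorphisms `SU(2) →* G`) `bind_map_mul_kick`;
  **`cycle_kicks_apply`** — the update cycle of the Haar kicks over a list, started at `g`, has the
  law `(listConv of the kick laws) · g` (used for one link here and for the lattice sweep later).

NOT CLAIMED: anything about the actual heat-bath weights beyond the pinching bound.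
-/

namespace Summit.Ventures.LatticeQCDFlow.Exactness

open Matrix MeasureTheory WithLp Metric Complex ProbabilityTheory Measure Set
open scoped ENNReal

variable {n : Type*} [Fintype n] [DecidableEq n]

/-! ## §1 One Cabibbo–Marinari hit dominates `ε ×` the Haar kick in its subgroup -/

section Hit

variable {m : Type*} [Fintype m] [DecidableEq m]

/-- The Doeblin constant of one hit: `ε(c, R) = e^{−2|c| Σ‖R‖}` (ratio of the bounds of the link weight). -/
noncomputable def hitConst (c : ℝ) (R : Matrix n n ℂ) : ℝ≥0∞ :=
  ENNReal.ofReal (Real.exp (-(|c| * ∑ i, ∑ j, ‖R i j‖))) *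
    (ENNReal.ofReal (Real.exp (|c| * ∑ i, ∑ j, ‖R i j‖)))⁻¹

omit [DecidableEq n] in
/-- It is positive … -/
theorem hitConst_ne_zero (c : ℝ) (R : Matrix n n ℂ) : hitConst c R ≠ 0 :=
  mul_ne_zero (by rw [Ne, ENNReal.ofReal_eq_zero, not_le]; exact Real.exp_pos _)
    (ENNReal.inv_ne_zero.2 ENNReal.ofReal_ne_top)

omit [DecidableEq n] in
/-- … and finite. -/
theorem hitConst_ne_top (c : ℝ) (R : Matrix n n ℂ) : hitConst c R ≠ ∞ :=
  ENNReal.mul_ne_top ENNReal.ofReal_ne_top (ENNReal.inv_ne_top.2 (by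
    rw [Ne, ENNReal.ofReal_eq_zero, not_le]; exact Real.exp_pos _))

/-- **One hit dominates `ε ×` the Haar kick**: `cmHit e c R g ≥ ε(c,R) · law(φ_e(h) g)`, `h ∼ Haar(SU(2))`. -/
theorem hitConst_smul_kick_le_cmHit (e : n ≃ Fin 2 ⊕ m) (c : ℝ) (R : Matrix n n ℂ) (g : Matrix.specialUnitaryGroup n ℂ) :
    hitConst c R • haarSU2.map (fun h => blockEmbSU e h * g) ≤ cmHit e c R g := by
  refine Measure.le_iff.2 fun B hB => ?_
  rw [Measure.smul_apply, smul_eq_mul, cmHit, subgroupHaarHeatBath_apply _ _ (measurable_blockEmbSU e)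
    (measurable_linkWeight c R) g hB, Measure.map_apply ((measurable_blockEmbSU e).mul_const g) hB,
    ← lintegral_indicator_one (((measurable_blockEmbSU e).mul_const g) hB),
    ← lintegral_const_mul' (hitConst c R) _ (hitConst_ne_top c R)]
  refine lintegral_mono fun h => ?_
  -- normaliser ≤ max weight
  have hZ : subgroupNorm haarSU2 (blockEmbSU e) (linkWeight c R) g ≤
      ENNReal.ofReal (Real.exp (|c| * ∑ i, ∑ j, ‖R i j‖)) := by
    unfold subgroupNorm
    calc ∫⁻ h, linkWeight c R (blockEmbSU e h * g) ∂haarSU2 ≤ ∫⁻ _, ENNReal.ofReal (Real.exp (|c| * ∑ i, ∑ j, ‖R i j‖)) ∂haarSU2 :=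
          lintegral_mono fun h => linkWeight_le c R _
      _ = _ := by rw [lintegral_const, measure_univ, mul_one]
  by_cases hmem : blockEmbSU e h * g ∈ B
  · have h1 : ((fun h => blockEmbSU e h * g) ⁻¹' B).indicator (1 : Matrix.specialUnitaryGroup (Fin 2) ℂ → ℝ≥0∞) h = 1 :=
      Set.indicator_of_mem (show h ∈ (fun h => blockEmbSU e h * g) ⁻¹' B from hmem) _
    rw [h1, mul_one, Set.indicator_of_mem hmem, Pi.one_apply, one_mul, hitConst]
    exact mul_le_mul' (le_linkWeight c R _) (ENNReal.inv_le_inv.2 hZ)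
  · have h1 : ((fun h => blockEmbSU e h * g) ⁻¹' B).indicator (1 : Matrix.specialUnitaryGroup (Fin 2) ℂ → ℝ≥0∞) h = 0 :=
      Set.indicator_of_notMem (show h ∉ (fun h => blockEmbSU e h * g) ⁻¹' B from hmem) _
    rw [h1, mul_zero]
    exact zero_le

end Hit

/-! ## §2 A cycle of Haar kicks is the convolution of the kick laws (any measurable group) -/

section Cycle

variable {G : Type*} [Group G] [MeasurableSpace G] [MeasurableMul₂ G]

/-- **Bind after a right translation**: kicking `y g` (`y ∼ ρ`) by an independent `ψ(h)`,
`h ∼ Haar(SU(2))`, gives `((Haar.map ψ) ∗ ρ)`-distributed `ψ(h) y`, times `g`. -/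
theorem bind_map_mul_kick (ρ : Measure G) [SFinite ρ] {ψ : Matrix.specialUnitaryGroup (Fin 2) ℂ → G}
    (hψ : Measurable ψ) (g : G) :
    (ρ.map (fun y => y * g)).bind (fun x => haarSU2.map (fun h => ψ h * x)) =
      (haarSU2.map ψ ∗ₘ ρ).map (fun x => x * g) := by
  haveI : IsProbabilityMeasure (haarSU2.map ψ) := Measure.isProbabilityMeasure_map hψ.aemeasurable
  have hκ : Measurable fun x : G => haarSU2.map (fun h => ψ h * x) := by
    refine Measure.measurable_of_measurable_coe _ fun s hs => ?_
    have h_eq : (fun x => (haarSU2.map fun h => ψ h * x) s) =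
        fun x => haarSU2 (Prod.mk x ⁻¹' {p : G × Matrix.specialUnitaryGroup (Fin 2) ℂ | ψ p.2 * p.1 ∈ s}) := by
      funext x; rw [Measure.map_apply (hψ.mul_const x) hs]; rfl
    rw [h_eq]
    exact measurable_measure_prodMk_left (((hψ.comp measurable_snd).mul measurable_fst) hs)
  ext B hB
  have hf : Measurable fun x : G => (haarSU2.map fun h => ψ h * x) B := (Measure.measurable_coe hB).comp hκ
  rw [Measure.bind_apply hB hκ.aemeasurable, lintegral_map hf (measurable_mul_const g),
    Measure.map_apply (measurable_mul_const g) hB, mconv_apply_right _ _ ((measurable_mul_const g) hB)]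
  refine lintegral_congr fun y => ?_
  rw [Measure.map_apply (hψ.mul_const _) hB, Measure.map_apply hψ ((measurable_mul_const y) ((measurable_mul_const g) hB))]
  congr 1
  ext h
  simp [mul_assoc]

/-- **A cycle of Haar kicks from `g` has the law of (convolution of the kick laws) `· g`**: for a
list of indices `ks` and measurable homomorphisms `ψ k : SU(2) →* G`, the update cycle of the kicks
`x ↦ ψ_k(h) x` (head of the list applied last) started at `g` is `(listConv (laws of ψ_k(h))) · g`. -/
theorem cycle_kicks_apply {κ : Type*} (ψ : κ → (Matrix.specialUnitaryGroup (Fin 2) ℂ →* G))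
    (hψ : ∀ k, Measurable (ψ k)) (g : G) :
    ∀ (ks : List κ),
      cycle (ks.map fun k => subgroupMove haarSU2 (ψ k) (hψ k)) g =
        (listConv (ks.map fun k => haarSU2.map (ψ k))).map (fun x => x * g)
  | [] => by
      rw [List.map_nil, cycle_nil, Kernel.id_apply, List.map_nil, listConv_nil,
        Measure.map_dirac' (measurable_mul_const (M := G) g) 1, one_mul]
  | k :: ks => by
      haveI := isProbabilityMeasure_listConv (ks.map fun k => haarSU2.map (ψ k)) fun μ hμ => by
        obtain ⟨k', -, rfl⟩ := List.mem_map.1 hμ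
        exact Measure.isProbabilityMeasure_map (hψ k').aemeasurable
      rw [List.map_cons, cycle_cons, Kernel.comp_apply, cycle_kicks_apply ψ hψ g ks, List.map_cons, listConv_cons]
      have hk : (fun x => (subgroupMove haarSU2 (ψ k) (hψ k)) x) = fun x => haarSU2.map (fun h => ψ k h * x) := by
        funext x; exact subgroupMove_apply _ _ _ x
      change Measure.bind _ (fun x => (subgroupMove haarSU2 (ψ k) (hψ k)) x) = _
      rw [hk]
      exact bind_map_mul_kick _ (hψ k) g

end Cycle

end Summit.Ventures.LatticeQCDFlow.Exactness
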